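import Literature.AnabelianGeometry.SemiGraphs.ThetaRayExoticMaximalCompact
import Literature.AnabelianGeometry.SemiGraphs.TemperedMaximalCompactAnchoredOfLocallyFinite
import HarnessLib

/-!
# Maximal compact subgroups at a locally finite graph are verticial or ANCHOR-FREE; at `𝒢_θ` both kinds occur

Mochizuki, *Semi-graphs of anabelioids*, Publ. RIMS **42** (2006), §3, Theorem 3.7 (iii)/(iv), manuscript
pp. 40–41 [cite: MochizukiSemiAnbd2006, Thm 3.7(iv) p.41].

PROOF-ONLY addendum (abc-iut cell, layer L3, seat abc-iut-L3-d4 gen 4, typed-form sweep «EXOTIC-IS-C»; label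
[typed-form audit, outside the [IUTchIII] Cor. 3.12 cone]; 0 definitions).  Combining abc-iut-w6-d062's dichotomy
at locally finite graphs (`le_verticial_or_anchorFree_of_isLocallyFinite`, p448045: a compact subgroup lies in a
verticial subgroup or meets every verticial subgroup trivially) with maximality:

* `isMaximalCompactSubgroup_dichotomy_of_isLocallyFinite` — at every countable LOCALLY FINITE graph of
  anabelioids satisfying the hypotheses of Thm 3.7 and every chart, a maximal compact subgroup is EITHER a
  verticial subgroup OR anchor-free (`K ⊓ H = 1` for every verticial `H`); the typed Thm 3.7 (iv) clause 1 is
  exactly the assertion that the second kind does not occur;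
* `thetaRayFreeProP_exists_isMaximalCompact_procyclic_anchorFree` — at abc-iut-L3-d1's countermodel
  `𝒢_θ(p, n)` the second kind DOES occur: the procyclic maximal compact subgroup of
  `ThetaRayExoticMaximalCompact.lean` (p455063) is anchor-free.

Erratum-grade, about the ∀-countable TYPING only; nothing of the IUT corpus is touched; no side taken.
-/

noncomputable section

namespace Literature.AnabelianGeometry.SemiGraphs

namespace ProfiniteSemiGraph

open Filter Topology

universe u

/-- **Maximal compact ⇒ verticial or anchor-free**, at every locally finite Thm-3.7 graph and every chart.
[cite: MochizukiSemiAnbd2006, Thm 3.7(iv) p.41] -/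
theorem isMaximalCompactSubgroup_dichotomy_of_isLocallyFinite {𝒢 : ProfiniteSemiGraph.{u}}
    (h37 : 𝒢.Thm37Hypotheses) (hlf : 𝒢.graph.IsLocallyFinite) (c : TemperedPiChart 𝒢) (K : Subgroup c.G)
    (hK : IsMaximalCompactSubgroup K) :
    (∃ v : 𝒢.graph.Vertex, K ∈ verticialSubgroups c v) ∨
      ∀ (v : 𝒢.graph.Vertex) (H : Subgroup c.G), H ∈ verticialSubgroups c v → K ⊓ H = ⊥ := by
  rcases 𝒢.le_verticial_or_anchorFree_of_isLocallyFinite h37 hlf c K hK.1 with ⟨v, H, hH, hKH⟩ | hfree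
  · left
    have hKH' : H = K := hK.2 H (isCompact_of_mem_verticialSubgroups c hH) hKH
    exact ⟨v, hKH' ▸ hH⟩
  · exact Or.inr hfree

variable (p : ℕ) [hp : Fact p.Prime] (n : ℕ → ℕ)

/-- **At `𝒢_θ(p, n)` anchor-free maximal compact subgroups EXIST**: the procyclic maximal compact subgroup
`C = closure⟨lim_k z_k⟩` of the canonical `π₁^temp(𝒢_θ)` (p455063) meets every verticial subgroup trivially.
[cite: MochizukiSemiAnbd2006, Thm 3.7(iv) p.41] -/
theorem thetaRayFreeProP_exists_isMaximalCompact_procyclic_anchorFree (hn : Tendsto n atTop atTop)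
    (h36 : (thetaRayFreeProP p n).Prop36Hypotheses) (h37 : (thetaRayFreeProP p n).Thm37Hypotheses) :
    ∃ C : Subgroup ((thetaRayFreeProP p n).temperedPiChart h36).G, IsMaximalCompactSubgroup C ∧
      (∃ c, C = (Subgroup.zpowers c).topologicalClosure) ∧
      ∀ (v : ℕ) (H : Subgroup ((thetaRayFreeProP p n).temperedPiChart h36).G),
        H ∈ verticialSubgroups ((thetaRayFreeProP p n).temperedPiChart h36) v → C ⊓ H = ⊥ := by
  obtain ⟨C, hC, hcyc, hCv⟩ := thetaRayFreeProP_exists_isMaximalCompact_procyclic p n hn h36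
  refine ⟨C, hC, hcyc, ?_⟩
  rcases isMaximalCompactSubgroup_dichotomy_of_isLocallyFinite h37 SemiGraph.ray_isLocallyFinite _ C hC with
    ⟨v, hCv'⟩ | hfree
  · exact absurd le_rfl (hCv v C hCv')
  · exact hfree

/-- **Both kinds of maximal compact subgroups occur at `𝒢_θ(p, n)`** (canonical chart): every maximal compact
subgroup is verticial or anchor-free, the verticial subgroups are maximal compact (abc-iut-w6-d062,
`isMaximalCompactSubgroup_of_mem_verticialSubgroups_of_isLocallyFinite`), and an anchor-free procyclic one
exists — the complete picture behind the kernel refutation p443103 of the typed Thm 3.7 (iv).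
[cite: MochizukiSemiAnbd2006, Thm 3.7(iv) p.41] -/
theorem thetaRayFreeProP_maximalCompact_picture (hn : Tendsto n atTop atTop)
    (h36 : (thetaRayFreeProP p n).Prop36Hypotheses) (h37 : (thetaRayFreeProP p n).Thm37Hypotheses) :
    (∀ K : Subgroup ((thetaRayFreeProP p n).temperedPiChart h36).G, IsMaximalCompactSubgroup K →
        (∃ v, K ∈ verticialSubgroups ((thetaRayFreeProP p n).temperedPiChart h36) v) ∨
          ∀ (v : ℕ) (H : Subgroup ((thetaRayFreeProP p n).temperedPiChart h36).G),
            H ∈ verticialSubgroups ((thetaRayFreeProP p n).temperedPiChart h36) v → K ⊓ H = ⊥) ∧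
      (∀ (v : ℕ) (K : Subgroup ((thetaRayFreeProP p n).temperedPiChart h36).G),
        K ∈ verticialSubgroups ((thetaRayFreeProP p n).temperedPiChart h36) v → IsMaximalCompactSubgroup K) ∧
      ∃ C : Subgroup ((thetaRayFreeProP p n).temperedPiChart h36).G, IsMaximalCompactSubgroup C ∧
        (∃ c, C = (Subgroup.zpowers c).topologicalClosure) ∧
        ∀ (v : ℕ) (H : Subgroup ((thetaRayFreeProP p n).temperedPiChart h36).G),
          H ∈ verticialSubgroups ((thetaRayFreeProP p n).temperedPiChart h36) v → C ⊓ H = ⊥ :=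
  ⟨fun K hK => isMaximalCompactSubgroup_dichotomy_of_isLocallyFinite h37 SemiGraph.ray_isLocallyFinite _ K hK,
    fun _ _ hK => (thetaRayFreeProP p n).isMaximalCompactSubgroup_of_mem_verticialSubgroups_of_isLocallyFinite
      h37 SemiGraph.ray_isLocallyFinite _ hK,
    thetaRayFreeProP_exists_isMaximalCompact_procyclic_anchorFree p n hn h36 h37⟩

end ProfiniteSemiGraph

end Literature.AnabelianGeometry.SemiGraphs

end
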